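import Summits.KontsevichZagierPeriods.KontsevichZagierPeriods.Theses.StandardParts
import Literature.NumberTheory.Transcendental.KZTameMoveFamily
import Literature.NumberTheory.Transcendental.KZBallPeelingAux

/-!
# `SpArcLifting` (stmt-KontsevichZagierPeriods-3155, route StandardParts) — BIRTH SKELETON `Lines/birth.lean`

Crux (rank 4, FIXED, never restated here):
`Summit.KontsevichZagierPeriods.KontsevichZagierPeriods.Theses.StandardParts.SpArcLifting` — every
equal-valued pair `(r, r')` of KZ-rational integral representations is the pair of `L¹`-endpoints
(`t → 0⁺`) of arcs `R : ℝ → KZ.IntegralRep n`, `R' : ℝ → KZ.IntegralRep m` with `ℚ`-semialgebraic total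
domains / integrands over `t ∈ (0,1)` and `KZ.Equivalent (R t) (R' t)` for every `t ∈ (0,1)`.

## What the typing does to the crux (recorded by three refuter reviews on items 3153/3155, and as the
## folklore caveat in the design notes of `Literature/NumberTheory/Transcendental/KZMoveFamily.lean`)

A `KZ.IntegralRep` carries a `ℚ`-semialgebraic domain and integrand, so every FIBRE `R t` of an admissible
arc is `ℚ`-semialgebraic; a `ℚ`-semialgebraic family all of whose fibres are `ℚ`-semialgebraic is locally
constant near every transcendental parameter (the set of parameters with a given `∅`-definable fibre is
`∅`-definable in `(ℝ,+,·,<)` — Tarski–Seidenberg over `ℚ` — hence a finite union of intervals with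
algebraic endpoints), so it is CONSTANT on some `(0, ε)`. Consequently, as typed,
`SpArcLifting ⇐ KontsevichZagierPeriods` (constant arcs: `arcs_of_equivalent` below, fully proved) and
`SpArcLifting ⇒ KontsevichZagierPeriods` (eventual constancy + the landed support item `SpAeCongruence`):
the crux is Conjecture 1 itself, and ANY skeleton of it is a skeleton of the period conjecture.

## The line: the route's two halves, RE-TYPED over raw `ℚ`-semialgebraic families (the refuters' FIX)

The honest decomposition is therefore the route's own thesis `X = closure ∧ lifting` with arcs re-typed so
that fibres may genuinely vary with `t`: an arc is a `KZ.RawFamily` (`KZTameMoveFamily.lean`: ONE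
`ℚ`-semialgebraic total domain `S ⊆ ℝⁿ⁺¹`, parameter last, ONE `ℚ`-semialgebraic total integrand; fibres
`S.fibre t`, `S.fibreFun t` are plain sets / functions, `ℚ`-semialgebraic at rational `t` by
`KZ.RawFamily.isSemialgebraic_fibre`), with
* fibre integrability on `(0,1)` (so that the `L¹`-clause `KZ.RawFamily.HasL1Limit` — verbatim the crux's
  `∫ |𝟙_{S_t} G_t − 𝟙_{σ} f| → 0` along `𝓝[>] 0` — carries no Bochner junk value; typing checklist (ii));
* "arc of identities" = at every RATIONAL parameter `q ∈ (0,1)`, ALL integral representations realising the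
  two fibres are `KZ.Equivalent` (realisations exist: the fibre at `q ∈ ℚ` is `ℚ`-semialgebraic and
  integrable; any two realisations of one fibre are congruent, `KZ.of_sub_of_mem_relations_of_eqOn`).

Stubs (2, both registered; neither is the crux or the summit — BC3 probes below; nearest existing items: the
per-move TAME closure lemmas TameCovLimit / TameNLLimit / AddLimits / TameLimitExists / DefinableChoice and
the complexity bound BoundedCost of route InequalityCost, which are the uniform-template sub-case of
`stub_rawArcClosure` for bounded data, and item 3153 `SpArcClosure`, whose informal text is
`stub_rawArcClosure` but whose typed form collapses like this crux):
* `stub_rawArcClosure` (XL, the tame-limit half = item 3153 `SpArcClosure` as its card meant it):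
  raw arcs of identities have KZ-equivalent `L¹`-endpoints. Summit-implied (values pass to the limit along
  rational `q → 0⁺`; `kzPeriodConjecture'_iff_isRational`), transcendence-free, and now NOT trivial: fibres
  vary, so the o-minimal "standard part of a semialgebraic family of move chains" mechanism (Hardt
  triviality; van den Dries 1998 Ch. 9; Cluckers–Miller 2011 for the asymptotic class of divergent
  intermediates) is exactly what a proof must supply.
* `stub_rawArcLifting` (open-problem-sized, the arithmetic half = this crux as its card meant it): every
  equal-valued KZ-rational pair is the `L¹`-endpoint pair of a raw arc of identities. Summit-implied
  (constant raw arcs `KZ.RawFamily.const`, `hasL1Limit_const`); arc ENGINES (Ayoub's relative theorem at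
  the generic fibre, Gauss–Manin certificates, parameter-as-variable transport) now have room to act,
  since e.g. the truncations `∫₀^{1−t}` of the route's Hoffman calibration ARE raw arcs (they are not
  `IntegralRep`-valued arcs at transcendental `t`).

Assembly `SpArcLifting_of : SpArcLifting` (uses the two stubs BY NAME, as `#h21_check_skeleton` requires; the
REAL proof is `summit_of_rawArcs (h₁ : <stub₁-sig>) (h₂ : <stub₂-sig>) : KontsevichZagierPeriods` — the
route's `closes` seam on the re-typed halves — followed by CONSTANT typed arcs
(`arcs_of_equivalent`: semialgebraicity of the cylinder `σ × (0,1)` and of `f ∘ Fin.init` on it from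
`KZ.IntegralRep.isSemialgebraicFamilyOn_const` / `.isSemialgebraic_totalSet` / `.isSemialgebraicFunOn_totalFun`
of `KZMoveFamily.lean` — `KZ.totalSet (Ioo 0 1) _` is definitionally the crux's total domain —, the
parameter interval from `KZ.BallPeeling.isSemialgebraic_posIoo`, and the `L¹`-clauses by `∫ |h − h| = 0`).

Audit (planner, 2026-08-17): `lean check --json` rc 0; sorries = 2 = stubs (`stub_rawArcClosure`,
`stub_rawArcLifting`), zero elsewhere; `summit_of_rawArcs` and `arcs_of_equivalent` axioms = [propext,
Classical.choice, Quot.sound]; `SpArcLifting_of` = those + `sorryAx` via the two stubs only.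
BC3 probes (planner folder `bc/probe_*.lean`, stub statement as hypothesis, nothing of this file imported):
for each stub, `stub → SpArcLifting` and `stub → KontsevichZagierPeriods`, each by `exact?`, `simpa`,
`aesop` separately and by the unfolded-target variants `simpa [C]`, `(unfold C; simpa)`, `(unfold C; aesop)`
(`maxHeartbeats 400000`): 24/24 FAIL (exact?: could not close; simpa: assumption failed; aesop: failed
after exhaustive search / heartbeat time-out; unsolved goals `⊢ SpArcLifting`, `⊢ KZ.Equivalent r r'`).
No `Disproof.lean` exists for this crux (`ledger crux ls`: no workfiles) — nothing to honour;
`ledger negatives --problem KontsevichZagierPeriods`: 1 entry (KinematicPlaneConvex), unrelated.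

References: M. Kontsevich, D. Zagier, *Periods* (2001), §1.2 [KontsevichZagier2001]; J. Ayoub, *Une version
relative de la conjecture des périodes de Kontsevich–Zagier*, Ann. Math. 181 (2015) [Ayoub2015,
AyoubRelKZRevisited]; L. van den Dries, *Tame topology and o-minimal structures* (1998), Ch. 6, 9 [Dries1998];
R. Cluckers, D. Miller, Duke Math. J. 156 (2011) [CluckersMiller2011]; J. Bochnak, M. Coste, M.-F. Roy,
*Real Algebraic Geometry* (1998), Thm 2.2.1 [BochnakCosteRoy1998].
-/

noncomputable section

open Set MeasureTheory Filter
open scoped Topology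
open Literature.NumberTheory.Transcendental
open Literature.ModelTheory.ExponentialFields (IsSemialgebraic)
open Summit.KontsevichZagierPeriods.KontsevichZagierPeriods.Theses.StandardParts (SpArcLifting)

namespace Summit.KontsevichZagierPeriods.KontsevichZagierPeriods.Cruxes.SpArcLifting.Birth

/-! ## Stubs of the line (registered on stmt-KontsevichZagierPeriods-3155) -/

/-- STUB `stub_rawArcClosure` (XL; the tame-limit half). **Closedness of KZ-equivalence at `L¹`-endpoints of
raw `ℚ`-semialgebraic arcs of identities.** Let `S`, `S'` be raw `ℚ`-semialgebraic one-parameter families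
(total data, `KZ.RawFamily`) in dimensions `n`, `m`, with integrable fibres over `t ∈ (0,1)`, which form an
ARC OF IDENTITIES: at every rational parameter `q ∈ (0,1)` all integral representations `ρ`, `ρ'` realising
the fibres `(S_q, G_q)`, `(S'_q, G'_q)` are `KZ.Equivalent`. If `S →_{L¹} r₀` and `S' →_{L¹} r₀'` as
`t → 0⁺` (`KZ.RawFamily.HasL1Limit`), then `KZ.Equivalent r₀ r₀'`.
Why plausibly true: it is implied by the summit (fibre values agree at rational `q`, pass to the limit,
`kzPeriodConjecture'_iff_isRational`), so a counterexample refutes Conjecture 1; mechanism: Hardt triviality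
makes a semialgebraic family of move chains combinatorially constant on `(0,ε)`, limits of semialgebraic
families of sets / maps / primitives are semialgebraic, and divergent intermediates have principal parts in
the constructible class `c·t^a·(log t)^k` — the "standard part" of the chain family is a chain at `t = 0`
unless an intermediate diverges. Why it might fail: chain complexity may blow up as `t → 0⁺`, and `log t`
principal parts may admit no semialgebraic counterterm families.
[cite: KontsevichZagier2001, §1.2] [cite: Dries1998, Ch. 9] [cite: CluckersMiller2011, Thm 1.3] -/
theorem stub_rawArcClosure : ∀ ⦃n m : ℕ⦄ (S : KZ.RawFamily n) (S' : KZ.RawFamily m)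
    (r₀ : KZ.IntegralRep n) (r₀' : KZ.IntegralRep m),
    (∀ t ∈ Set.Ioo (0:ℝ) 1, IntegrableOn (S.fibreFun t) (S.fibre t)) →
    (∀ t ∈ Set.Ioo (0:ℝ) 1, IntegrableOn (S'.fibreFun t) (S'.fibre t)) →
    (∀ q : ℚ, (q : ℝ) ∈ Set.Ioo (0:ℝ) 1 → ∀ (ρ : KZ.IntegralRep n) (ρ' : KZ.IntegralRep m),
      ρ.domain = S.fibre q → Set.EqOn ρ.integrand (S.fibreFun q) (S.fibre q) →
      ρ'.domain = S'.fibre q → Set.EqOn ρ'.integrand (S'.fibreFun q) (S'.fibre q) →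
      KZ.Equivalent ρ ρ') →
    S.HasL1Limit r₀ → S'.HasL1Limit r₀' → KZ.Equivalent r₀ r₀' := by
  sorry

/-- STUB `stub_rawArcLifting` (open-problem-sized; the arithmetic half). **Lifting equal-valued pairs to raw
arcs of identities.** Every pair `(r, r')` of integral representations of KZ's literal rational shape with
`r.value = r'.value` is the pair of `L¹`-endpoints (`t → 0⁺`) of raw `ℚ`-semialgebraic families `S`, `S'`
with integrable fibres over `(0,1)` forming an arc of identities (all realisations of the fibres at each
rational `q ∈ (0,1)` are `KZ.Equivalent`).
Why plausibly true: implied by the summit via the constant raw families `KZ.RawFamily.const r`,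
`KZ.RawFamily.const r'` (`hasL1Limit_const`; realisations of `(σ, f)` are congruent to `r` by
`KZ.of_sub_of_mem_relations_of_eqOn`). Intended engines (arcs that genuinely move, which the raw typing now
admits): functional identities at the generic fibre (Ayoub's relative version of the conjecture),
Gauss–Manin / Picard–Fuchs certificates, parameter-as-variable transport of constants. Why it might fail: at
an isolated algebraic point of the coincidence locus `{v(r_s) = v(r'_s)}` every arc through `(r, r')` runs
inside the two equivalence classes, so there the statement is Conjecture 1 itself (rigid identities at
special fibres). [cite: KontsevichZagier2001, §1.2 Conjecture 1] [cite: Ayoub2015, Thm 1.2]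
[cite: HuberMullerStach2017, Ch. 13] -/
theorem stub_rawArcLifting : ∀ ⦃n m : ℕ⦄ (r : KZ.IntegralRep n) (r' : KZ.IntegralRep m),
    r.IsRational → r'.IsRational → r.value = r'.value →
    ∃ (S : KZ.RawFamily n) (S' : KZ.RawFamily m),
      (∀ t ∈ Set.Ioo (0:ℝ) 1, IntegrableOn (S.fibreFun t) (S.fibre t)) ∧
      (∀ t ∈ Set.Ioo (0:ℝ) 1, IntegrableOn (S'.fibreFun t) (S'.fibre t)) ∧
      (∀ q : ℚ, (q : ℝ) ∈ Set.Ioo (0:ℝ) 1 → ∀ (ρ : KZ.IntegralRep n) (ρ' : KZ.IntegralRep m),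
        ρ.domain = S.fibre q → Set.EqOn ρ.integrand (S.fibreFun q) (S.fibre q) →
        ρ'.domain = S'.fibre q → Set.EqOn ρ'.integrand (S'.fibreFun q) (S'.fibre q) →
        KZ.Equivalent ρ ρ') ∧
      S.HasL1Limit r ∧ S'.HasL1Limit r' := by
  sorry

/-! ## Glue (fully proved) -/

/-- The two re-typed halves decide the summit (the route's `closes` seam, on raw arcs): lift the pair to a
raw arc of identities (`h₂`), then close at the endpoints (`h₁`). Hypotheses are LITERALLY the statements of
`stub_rawArcClosure` / `stub_rawArcLifting`; the proof is `sorry`-free. [folklore] -/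
theorem summit_of_rawArcs
    (h₁ : ∀ ⦃n m : ℕ⦄ (S : KZ.RawFamily n) (S' : KZ.RawFamily m)
      (r₀ : KZ.IntegralRep n) (r₀' : KZ.IntegralRep m),
      (∀ t ∈ Set.Ioo (0:ℝ) 1, IntegrableOn (S.fibreFun t) (S.fibre t)) →
      (∀ t ∈ Set.Ioo (0:ℝ) 1, IntegrableOn (S'.fibreFun t) (S'.fibre t)) →
      (∀ q : ℚ, (q : ℝ) ∈ Set.Ioo (0:ℝ) 1 → ∀ (ρ : KZ.IntegralRep n) (ρ' : KZ.IntegralRep m),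
        ρ.domain = S.fibre q → Set.EqOn ρ.integrand (S.fibreFun q) (S.fibre q) →
        ρ'.domain = S'.fibre q → Set.EqOn ρ'.integrand (S'.fibreFun q) (S'.fibre q) →
        KZ.Equivalent ρ ρ') →
      S.HasL1Limit r₀ → S'.HasL1Limit r₀' → KZ.Equivalent r₀ r₀')
    (h₂ : ∀ ⦃n m : ℕ⦄ (r : KZ.IntegralRep n) (r' : KZ.IntegralRep m),
      r.IsRational → r'.IsRational → r.value = r'.value →
      ∃ (S : KZ.RawFamily n) (S' : KZ.RawFamily m),
        (∀ t ∈ Set.Ioo (0:ℝ) 1, IntegrableOn (S.fibreFun t) (S.fibre t)) ∧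
        (∀ t ∈ Set.Ioo (0:ℝ) 1, IntegrableOn (S'.fibreFun t) (S'.fibre t)) ∧
        (∀ q : ℚ, (q : ℝ) ∈ Set.Ioo (0:ℝ) 1 → ∀ (ρ : KZ.IntegralRep n) (ρ' : KZ.IntegralRep m),
          ρ.domain = S.fibre q → Set.EqOn ρ.integrand (S.fibreFun q) (S.fibre q) →
          ρ'.domain = S'.fibre q → Set.EqOn ρ'.integrand (S'.fibreFun q) (S'.fibre q) →
          KZ.Equivalent ρ ρ') ∧
        S.HasL1Limit r ∧ S'.HasL1Limit r') :
    KontsevichZagierPeriods := by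
  intro n m r r' hr hr' hv
  obtain ⟨S, S', hi, hi', heq, hl, hl'⟩ := h₂ r r' hr hr' hv
  exact h₁ S S' r r' hi hi' heq hl hl'

/-- **Constant arcs.** A `KZ.Equivalent` pair `(r, r')` is the pair of `L¹`-endpoints of typed arcs of
identities in the sense of the crux: take `R t = r`, `R' t = r'`; the total domain over `(0,1)` is the
cylinder `σ × (0,1)` and the total integrand is `f ∘ Fin.init`, both `ℚ`-semialgebraic
(`KZ.IntegralRep.isSemialgebraicFamilyOn_const` and the total-space lemmas of `KZMoveFamily.lean` —
`KZ.totalSet (Ioo 0 1) _` is definitionally the crux's total domain —, `KZ.BallPeeling.isSemialgebraic_posIoo`);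
fibrewise equivalence is `r ∼ r'`; the `L¹`-distances are identically `0`. This is the (elementary) half
"summit ⇒ crux" of the summit-equivalence of the typed crux. [cite: KontsevichZagier2001, §1.2] -/
theorem arcs_of_equivalent {n m : ℕ} (r : KZ.IntegralRep n) (r' : KZ.IntegralRep m)
    (hrr' : KZ.Equivalent r r') :
    ∃ (R : ℝ → KZ.IntegralRep n) (R' : ℝ → KZ.IntegralRep m),
      IsSemialgebraic ℚ {z : Fin (n + 1) → ℝ | z (Fin.last n) ∈ Set.Ioo (0:ℝ) 1 ∧
        Fin.init z ∈ (R (z (Fin.last n))).domain} ∧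
      IsSemialgebraicFunOn ℚ {z : Fin (n + 1) → ℝ | z (Fin.last n) ∈ Set.Ioo (0:ℝ) 1 ∧
        Fin.init z ∈ (R (z (Fin.last n))).domain} (fun z => (R (z (Fin.last n))).integrand (Fin.init z)) ∧
      IsSemialgebraic ℚ {z : Fin (m + 1) → ℝ | z (Fin.last m) ∈ Set.Ioo (0:ℝ) 1 ∧
        Fin.init z ∈ (R' (z (Fin.last m))).domain} ∧
      IsSemialgebraicFunOn ℚ {z : Fin (m + 1) → ℝ | z (Fin.last m) ∈ Set.Ioo (0:ℝ) 1 ∧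
        Fin.init z ∈ (R' (z (Fin.last m))).domain} (fun z => (R' (z (Fin.last m))).integrand (Fin.init z)) ∧
      (∀ t ∈ Set.Ioo (0:ℝ) 1, KZ.Equivalent (R t) (R' t)) ∧
      Tendsto (fun t : ℝ => ∫ x, |(R t).domain.indicator (R t).integrand x -
        r.domain.indicator r.integrand x|) (𝓝[>] (0:ℝ)) (𝓝 0) ∧
      Tendsto (fun t : ℝ => ∫ x, |(R' t).domain.indicator (R' t).integrand x -
        r'.domain.indicator r'.integrand x|) (𝓝[>] (0:ℝ)) (𝓝 0) := by
  have hT : IsSemialgebraic ℚ {x : Fin 1 → ℝ | x 0 ∈ Set.Ioo (0:ℝ) 1} :=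
    KZ.BallPeeling.isSemialgebraic_posIoo
  have hR := KZ.IntegralRep.isSemialgebraicFamilyOn_const (Set.Ioo (0:ℝ) 1) r
  have hR' := KZ.IntegralRep.isSemialgebraicFamilyOn_const (Set.Ioo (0:ℝ) 1) r'
  refine ⟨fun _ => r, fun _ => r', hR.isSemialgebraic_totalSet hT, hR.isSemialgebraicFunOn_totalFun hT,
    hR'.isSemialgebraic_totalSet hT, hR'.isSemialgebraicFunOn_totalFun hT, fun t _ => hrr', ?_, ?_⟩
  · simp only [sub_self, abs_zero, integral_zero]
    exact tendsto_const_nhds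
  · simp only [sub_self, abs_zero, integral_zero]
    exact tendsto_const_nhds

/-! ## Assembly (kernel-checked; `sorry` only through the two declared stubs): concludes the crux BY NAME -/

/-- **ASSEMBLY `SpArcLifting_of`.** The registered stubs `stub_rawArcClosure`, `stub_rawArcLifting` give the
summit (`summit_of_rawArcs`, sorry-free in its two hypotheses) and the summit gives the typed crux by constant
arcs (`arcs_of_equivalent`, sorry-free). This is the ONLY theorem of the file concluding
`StandardParts.SpArcLifting` by name (the `#h21_check_skeleton` audit takes it as the skeleton; its axioms are
the whitelist plus `sorryAx` through the two stubs exactly). [cite: KontsevichZagier2001, §1.2 Conjecture 1] -/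
theorem SpArcLifting_of : SpArcLifting := by
  intro n m r r' hr hr' hv
  exact arcs_of_equivalent r r'
    (summit_of_rawArcs stub_rawArcClosure stub_rawArcLifting r r' hr hr' hv)

end Summit.KontsevichZagierPeriods.KontsevichZagierPeriods.Cruxes.SpArcLifting.Birth
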